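import Summits.Ventures.PercRepro.SixFourT4IdentityA

/-!
# PercRepro — C-025 at `(6,4)`, LEMMA 22.1 IN THE KERNEL, part B: the fibres and the identity (p3, gen 8)

Continuation of `SixFourT4IdentityA.lean` (the quantities of §22.0, the subset counts, `N₄ + T₃ = 2^g`, `DF₄ + X = T₃`):
the fibres over planes / lines (`fiber_plane_eq`, `fiber_line_eq`, `fiber4_plane_eq`, `fiber4_line_eq`), `T3_eq`, `I4_eq`,
`pp_add_two_lpp_eq` and mine-2's structural identity `J_four_identity`.
-/

namespace PercRepro.SixFour

open Finset ThmH

variable {α : Type*} [DecidableEq α] {M : Matroid α} [M.Finite] {G : Finset α}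

/-! ## Fibres over planes and lines -/

/-- The rank-`3` sets with `≥ 4` points whose closure is the plane `P` are exactly the `D₃`-sets of `P ∩ G`. -/
theorem fiber_plane_eq (hG : G ⊆ gr M) {P : Finset α} (hP : P ∈ planes M) :
    (G.powerset.filter (fun Z : Finset α => 4 ≤ Z.card ∧ M.eRk (Z : Set α) = 3)).filter
      (fun Z : Finset α => clF M Z = P) =
      (P ∩ G).powerset.filter (fun S : Finset α => 4 ≤ S.card ∧ M.eRk (S : Set α) = 3) := by
  ext Z
  simp only [Finset.mem_filter, Finset.mem_powerset]
  constructor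
  · rintro ⟨⟨hZG, h4, hr⟩, hcl⟩
    refine ⟨Finset.subset_inter ?_ hZG, h4, hr⟩
    rw [← hcl, ← Finset.coe_subset, coe_clF]
    exact M.subset_closure _ (by rw [← coe_gr M]; exact Finset.coe_subset.2 (hZG.trans hG))
  · rintro ⟨hZ, h4, hr⟩
    refine ⟨⟨hZ.trans Finset.inter_subset_right, h4, hr⟩, ?_⟩
    apply Finset.coe_injective
    rw [coe_clF]
    exact closure_eq_of_subset_plane hP (hZ.trans Finset.inter_subset_left) hr

/-- The rank-`2` sets with `≥ 4` points whose closure is the line `L` are exactly the `≥ 4`-subsets of `L ∩ G`. -/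
theorem fiber_line_eq (hs : Simple M) (hG : G ⊆ gr M) {L : Finset α} (hL : L ∈ lines M) :
    (G.powerset.filter (fun Z : Finset α => 4 ≤ Z.card ∧ M.eRk (Z : Set α) = 2)).filter
      (fun Z : Finset α => clF M Z = L) =
      (L ∩ G).powerset.filter (fun S : Finset α => 4 ≤ S.card) := by
  ext Z
  simp only [Finset.mem_filter, Finset.mem_powerset]
  constructor
  · rintro ⟨⟨hZG, h4, -⟩, hcl⟩
    refine ⟨Finset.subset_inter ?_ hZG, h4⟩
    rw [← hcl, ← Finset.coe_subset, coe_clF]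
    exact M.subset_closure _ (by rw [← coe_gr M]; exact Finset.coe_subset.2 (hZG.trans hG))
  · rintro ⟨hZ, h4⟩
    have hr := eRk_eq_two_of_subset_line hs hL (hZ.trans Finset.inter_subset_left) (by omega)
    refine ⟨⟨hZ.trans Finset.inter_subset_right, h4, hr⟩, ?_⟩
    apply Finset.coe_injective
    rw [coe_clF]
    exact closure_eq_of_subset_line hL (hZ.trans Finset.inter_subset_left) hr

omit [DecidableEq α] in
/-- A subset of `G` with at least `2` points has rank at least `2` (simple matroid). -/
theorem two_le_eRk_of_two_le_card (hs : Simple M) (hG : G ⊆ gr M) {Z : Finset α} (hZ : Z ⊆ G)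
    (h2 : 2 ≤ Z.card) : 2 ≤ M.eRk (Z : Set α) := by
  obtain ⟨a, ha, b, hb, hab⟩ := Finset.one_lt_card.1 (by omega : 1 < Z.card)
  exact two_le_eRk_of_two_mem hs (hZ.trans hG) ha hb hab

/-- `T₃ = S₃(g) + Σ_ρ D₃(ρ) + Σ_ℓ δ(m_ℓ)`. -/
theorem T3_eq (hs : Simple M) (hG : G ⊆ gr M) :
    T3cnt M G = S3 G.card + ∑ P ∈ planes M, D3 M G P + ∑ L ∈ lines M, delta (L ∩ G).card := by
  unfold T3cnt
  -- split off the sets with `≤ 3` points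
  have h1 := Finset.card_filter_add_card_filter_not
    (s := G.powerset.filter (fun Z : Finset α => M.eRk (Z : Set α) ≤ 3)) (fun Z : Finset α => Z.card ≤ 3)
  rw [Finset.filter_filter, Finset.filter_filter] at h1
  have e1 : G.powerset.filter (fun Z : Finset α => M.eRk (Z : Set α) ≤ 3 ∧ Z.card ≤ 3) =
      G.powerset.filter (fun Z : Finset α => Z.card ≤ 3) := by
    refine Finset.filter_congr (fun Z _ => ⟨fun h => h.2, fun h => ⟨?_, h⟩⟩)
    have := M.eRk_le_encard (Z : Set α)
    rw [Set.encard_coe_eq_coe_finsetCard] at this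
    exact this.trans (by exact_mod_cast h)
  rw [e1, card_powerset_filter_card_le_three] at h1
  -- the sets with `≥ 4` points of rank `≤ 3` have rank `3` or `2`
  have h2 := Finset.card_filter_add_card_filter_not
    (s := G.powerset.filter (fun Z : Finset α => M.eRk (Z : Set α) ≤ 3 ∧ ¬ Z.card ≤ 3))
    (fun Z : Finset α => M.eRk (Z : Set α) = 3)
  rw [Finset.filter_filter, Finset.filter_filter] at h2
  have e3 : G.powerset.filter (fun Z : Finset α => (M.eRk (Z : Set α) ≤ 3 ∧ ¬ Z.card ≤ 3) ∧ M.eRk (Z : Set α) = 3) =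
      G.powerset.filter (fun Z : Finset α => 4 ≤ Z.card ∧ M.eRk (Z : Set α) = 3) :=
    Finset.filter_congr (fun Z _ => ⟨fun h => ⟨by omega, h.2⟩, fun h => ⟨⟨h.2.le, by omega⟩, h.2⟩⟩)
  have e2 : G.powerset.filter (fun Z : Finset α => (M.eRk (Z : Set α) ≤ 3 ∧ ¬ Z.card ≤ 3) ∧
      ¬ M.eRk (Z : Set α) = 3) = G.powerset.filter (fun Z : Finset α => 4 ≤ Z.card ∧ M.eRk (Z : Set α) = 2) := by
    refine Finset.filter_congr (fun Z hZ => ?_)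
    rw [Finset.mem_powerset] at hZ
    constructor
    · rintro ⟨⟨h3, hc⟩, hne⟩
      refine ⟨by omega, ?_⟩
      have hle2 : M.eRk (Z : Set α) ≤ 2 := by
        by_contra h
        exact hne (eRk_eq_of_le_of_not_le (n := 2) h3 h)
      exact le_antisymm hle2 (two_le_eRk_of_two_le_card hs hG hZ (by omega))
    · rintro ⟨hc, hr2⟩
      refine ⟨⟨by rw [hr2]; decide, by omega⟩, by rw [hr2]; decide⟩
  rw [e3, e2] at h2
  -- fibre the rank-`3` part over the planes and the rank-`2` part over the lines
  have hpl : (G.powerset.filter (fun Z : Finset α => 4 ≤ Z.card ∧ M.eRk (Z : Set α) = 3)).card =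
      ∑ P ∈ planes M, D3 M G P := by
    rw [Finset.card_eq_sum_card_fiberwise (f := fun Z => clF M Z) (t := planes M) (fun Z hZ => by
      rw [Finset.mem_coe, Finset.mem_filter, Finset.mem_powerset] at hZ
      exact Finset.mem_coe.2 (clF_mem_planes (hZ.1.trans hG) hZ.2.2).1)]
    exact Finset.sum_congr rfl (fun P hP => by rw [fiber_plane_eq hG hP]; rfl)
  have hln : (G.powerset.filter (fun Z : Finset α => 4 ≤ Z.card ∧ M.eRk (Z : Set α) = 2)).card =
      ∑ L ∈ lines M, delta (L ∩ G).card := by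
    rw [Finset.card_eq_sum_card_fiberwise (f := fun Z => clF M Z) (t := lines M) (fun Z hZ => by
      rw [Finset.mem_coe, Finset.mem_filter, Finset.mem_powerset] at hZ
      exact Finset.mem_coe.2 (clF_mem_lines (hZ.1.trans hG) hZ.2.2).1)]
    exact Finset.sum_congr rfl (fun L hL => by rw [fiber_line_eq hs hG hL, card_powerset_filter_four_le])
  omega

/-! ## `I₄ + Σ_ρ r₃(ρ,4) + Σ_ℓ C(m_ℓ,4) = C(g,4)` -/

/-- The rank-`3` `4`-sets whose closure is the plane `P` are the `r₃(ρ,4)`-sets of `P ∩ G`. -/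
theorem fiber4_plane_eq (hG : G ⊆ gr M) {P : Finset α} (hP : P ∈ planes M) :
    ((G.powersetCard 4).filter (fun Z : Finset α => M.eRk (Z : Set α) = 3)).filter
      (fun Z : Finset α => clF M Z = P) =
      ((P ∩ G).powersetCard 4).filter (fun S : Finset α => M.eRk (S : Set α) = 3) := by
  ext Z
  simp only [Finset.mem_filter, Finset.mem_powersetCard]
  constructor
  · rintro ⟨⟨⟨hZG, hc⟩, hr⟩, hcl⟩
    refine ⟨⟨Finset.subset_inter ?_ hZG, hc⟩, hr⟩
    rw [← hcl, ← Finset.coe_subset, coe_clF]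
    exact M.subset_closure _ (by rw [← coe_gr M]; exact Finset.coe_subset.2 (hZG.trans hG))
  · rintro ⟨⟨hZ, hc⟩, hr⟩
    refine ⟨⟨⟨hZ.trans Finset.inter_subset_right, hc⟩, hr⟩, ?_⟩
    apply Finset.coe_injective
    rw [coe_clF]
    exact closure_eq_of_subset_plane hP (hZ.trans Finset.inter_subset_left) hr

/-- The rank-`2` `4`-sets whose closure is the line `L` are all the `4`-subsets of `L ∩ G`. -/
theorem fiber4_line_eq (hs : Simple M) (hG : G ⊆ gr M) {L : Finset α} (hL : L ∈ lines M) :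
    ((G.powersetCard 4).filter (fun Z : Finset α => M.eRk (Z : Set α) = 2)).filter
      (fun Z : Finset α => clF M Z = L) = (L ∩ G).powersetCard 4 := by
  ext Z
  simp only [Finset.mem_filter, Finset.mem_powersetCard]
  constructor
  · rintro ⟨⟨⟨hZG, hc⟩, -⟩, hcl⟩
    refine ⟨Finset.subset_inter ?_ hZG, hc⟩
    rw [← hcl, ← Finset.coe_subset, coe_clF]
    exact M.subset_closure _ (by rw [← coe_gr M]; exact Finset.coe_subset.2 (hZG.trans hG))
  · rintro ⟨hZ, hc⟩
    have hr := eRk_eq_two_of_subset_line hs hL (hZ.trans Finset.inter_subset_left) (by omega)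
    refine ⟨⟨⟨hZ.trans Finset.inter_subset_right, hc⟩, hr⟩, ?_⟩
    apply Finset.coe_injective
    rw [coe_clF]
    exact closure_eq_of_subset_line hL (hZ.trans Finset.inter_subset_left) hr

/-- `I₄ + Σ_ρ r₃(ρ,4) + Σ_ℓ C(m_ℓ,4) = C(g,4)`. -/
theorem I4_eq (hs : Simple M) (hG : G ⊆ gr M) (hr : M.eRk (G : Set α) = 4) :
    I4 M G + ∑ P ∈ planes M, r34 M G P + ∑ L ∈ lines M, (L ∩ G).card.choose 4 = G.card.choose 4 := by
  unfold I4
  rw [filter_R4_card_four]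
  have h1 := Finset.card_filter_add_card_filter_not (s := G.powersetCard 4) (fun Z : Finset α => M.eRk (Z : Set α) = 4)
  have h2 := Finset.card_filter_add_card_filter_not
    (s := (G.powersetCard 4).filter (fun Z : Finset α => ¬ M.eRk (Z : Set α) = 4))
    (fun Z : Finset α => M.eRk (Z : Set α) = 3)
  rw [Finset.filter_filter, Finset.filter_filter] at h2
  have e3 : (G.powersetCard 4).filter (fun Z : Finset α => ¬ M.eRk (Z : Set α) = 4 ∧ M.eRk (Z : Set α) = 3) =
      (G.powersetCard 4).filter (fun Z : Finset α => M.eRk (Z : Set α) = 3) :=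
    Finset.filter_congr (fun Z _ => ⟨fun h => h.2, fun h => ⟨by rw [h]; decide, h⟩⟩)
  have e2 : (G.powersetCard 4).filter (fun Z : Finset α => ¬ M.eRk (Z : Set α) = 4 ∧ ¬ M.eRk (Z : Set α) = 3) =
      (G.powersetCard 4).filter (fun Z : Finset α => M.eRk (Z : Set α) = 2) := by
    refine Finset.filter_congr (fun Z hZ => ?_)
    obtain ⟨hZG, hc⟩ := Finset.mem_powersetCard.1 hZ
    constructor
    · rintro ⟨h4, h3⟩
      have hle3 : M.eRk (Z : Set α) ≤ 3 := (eRk_le_three_iff_ne_four' hr hZG).2 h4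
      have hle2 : M.eRk (Z : Set α) ≤ 2 := by
        by_contra h
        exact h3 (eRk_eq_of_le_of_not_le (n := 2) hle3 h)
      exact le_antisymm hle2 (two_le_eRk_of_two_le_card hs hG hZG (by omega))
    · intro h2
      exact ⟨by rw [h2]; decide, by rw [h2]; decide⟩
  rw [e3, e2] at h2
  have hpl : ((G.powersetCard 4).filter (fun Z : Finset α => M.eRk (Z : Set α) = 3)).card =
      ∑ P ∈ planes M, r34 M G P := by
    rw [Finset.card_eq_sum_card_fiberwise (f := fun Z => clF M Z) (t := planes M) (fun Z hZ => by
      rw [Finset.mem_coe, Finset.mem_filter, Finset.mem_powersetCard] at hZ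
      exact Finset.mem_coe.2 (clF_mem_planes (hZ.1.1.trans hG) hZ.2).1)]
    exact Finset.sum_congr rfl (fun P hP => by rw [fiber4_plane_eq hG hP]; rfl)
  have hln : ((G.powersetCard 4).filter (fun Z : Finset α => M.eRk (Z : Set α) = 2)).card =
      ∑ L ∈ lines M, (L ∩ G).card.choose 4 := by
    rw [Finset.card_eq_sum_card_fiberwise (f := fun Z => clF M Z) (t := lines M) (fun Z hZ => by
      rw [Finset.mem_coe, Finset.mem_filter, Finset.mem_powersetCard] at hZ
      exact Finset.mem_coe.2 (clF_mem_lines (hZ.1.1.trans hG) hZ.2).1)]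
    exact Finset.sum_congr rfl (fun L hL => by rw [fiber4_line_eq hs hG hL, Finset.card_powersetCard])
  rw [Finset.card_powersetCard] at h1
  omega

/-! ## `pp + 2·lpp = Σ_ρ (g − p)·D₃(ρ)` -/

/-- `|G ∖ cl(B)| + |cl(B) ∩ G| = g`. -/
theorem card_offCl_add' (B : Finset α) : (offCl M G B).card + (clF M B ∩ G).card = G.card := by
  rw [offCl_eq_sdiff, Finset.card_sdiff_add_card_eq_card Finset.inter_subset_right]

/-- `pp + 2·lpp = Σ_ρ (g − p)·D₃(ρ)`: the pairs `(B″, x)` of `sum_mTr_eq_sum_offCl` grouped by the closure plane. -/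
theorem pp_add_two_lpp_eq (hs : Simple M) (hG : G ⊆ gr M) :
    pp M G + 2 * lpp M G = ∑ P ∈ planes M, (G.card - (P ∩ G).card) * D3 M G P := by
  rw [pp_add_two_lpp hs hG, sum_mTr_eq_sum_offCl hG]
  have hmaps : ∀ B ∈ T3 M G, clF M B ∈ planes M := by
    intro B hB
    obtain ⟨hBG, hr, -⟩ := mem_T3.1 hB
    exact (clF_mem_planes_of_rank_three hG hBG hr).1
  rw [← Finset.sum_fiberwise_of_maps_to hmaps]
  refine Finset.sum_congr rfl (fun P hP => ?_)
  have hfib : (T3 M G).filter (fun B : Finset α => clF M B = P) =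
      (P ∩ G).powerset.filter (fun S : Finset α => 4 ≤ S.card ∧ M.eRk (S : Set α) = 3) := by
    rw [← fiber_plane_eq hG hP]
    congr 1
    unfold T3
    exact Finset.filter_congr (fun B _ => and_comm)
  have hpt : ∀ B ∈ (T3 M G).filter (fun B : Finset α => clF M B = P),
      (offCl M G B).card = G.card - (P ∩ G).card := by
    intro B hB
    have hPB : clF M B = P := (Finset.mem_filter.1 hB).2
    have := card_offCl_add' (M := M) (G := G) B
    rw [hPB] at this
    omega
  rw [Finset.sum_congr rfl hpt, Finset.sum_const, smul_eq_mul, hfib, mul_comm]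
  rfl

/-! ## LEMMA 22.1 -/

/-- **Lemma 22.1** (mine-2 §22.1): the structural identity
`J₄ = F(g) − Σ_ρ cost_g(ρ) + Σ_ℓ bonus(m_ℓ) + (2/3)·lpp − (6/5)·X`. -/
theorem J_four_identity (hs : Simple M) (hG : G ⊆ gr M) (hr : M.eRk (G : Set α) = 4) :
    J M G 4 = Fg G.card - ∑ P ∈ planes M, cost M G P + ∑ L ∈ lines M, bonus (L ∩ G).card +
      2 / 3 * (lpp M G : ℚ) - 6 / 5 * (Xcnt M G : ℚ) := by
  rw [J_four_eq hs hG]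
  have h1 : (N4 M G : ℚ) + T3cnt M G = (2 : ℚ) ^ G.card := by exact_mod_cast N4_add_T3 hr
  have h2 : (DF M G 4 : ℚ) + Xcnt M G = T3cnt M G := by exact_mod_cast DF_four_add_X hr
  have h3 : (T3cnt M G : ℚ) = S3 G.card + ∑ P ∈ planes M, (D3 M G P : ℚ) + ∑ L ∈ lines M, (delta (L ∩ G).card : ℚ) := by
    have := T3_eq hs hG
    exact_mod_cast this
  have h4 : (I4 M G : ℚ) + ∑ P ∈ planes M, (r34 M G P : ℚ) + ∑ L ∈ lines M, ((L ∩ G).card.choose 4 : ℚ) =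
      (G.card.choose 4 : ℚ) := by
    have := I4_eq hs hG hr
    exact_mod_cast this
  have h5 : (pp M G : ℚ) + 2 * lpp M G = ∑ P ∈ planes M, ((G.card : ℚ) - (P ∩ G).card) * (D3 M G P : ℚ) := by
    have := pp_add_two_lpp_eq hs hG
    have hc : ∀ P ∈ planes M, ((G.card - (P ∩ G).card : ℕ) : ℚ) = (G.card : ℚ) - (P ∩ G).card := by
      intro P _
      exact Nat.cast_sub (Finset.card_le_card Finset.inter_subset_right)
    rw [← Finset.sum_congr rfl (fun P hP => by rw [← hc P hP])]
    exact_mod_cast this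
  have hcost : ∑ P ∈ planes M, cost M G P =
      ∑ P ∈ planes M, ((G.card : ℚ) - (P ∩ G).card) * (D3 M G P : ℚ) - 2 / 5 * ∑ P ∈ planes M, (D3 M G P : ℚ) -
        8 / 5 * ∑ P ∈ planes M, (r34 M G P : ℚ) := by
    rw [Finset.mul_sum, Finset.mul_sum, ← Finset.sum_sub_distrib, ← Finset.sum_sub_distrib]
    refine Finset.sum_congr rfl (fun P _ => ?_)
    unfold cost
    ring
  have hbonus : ∑ L ∈ lines M, bonus (L ∩ G).card =
      2 / 5 * ∑ L ∈ lines M, (delta (L ∩ G).card : ℚ) + 8 / 5 * ∑ L ∈ lines M, ((L ∩ G).card.choose 4 : ℚ) := by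
    rw [Finset.mul_sum, Finset.mul_sum, ← Finset.sum_add_distrib]
    rfl
  rw [hcost, hbonus]
  unfold Fg
  linarith

end PercRepro.SixFour
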